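import Mathlib.Geometry.Euclidean.Volume.Measure
import Mathlib.Analysis.InnerProductSpace.Projection.Basic
import Mathlib.Analysis.Calculus.FDeriv.RestrictScalars
import Mathlib.Analysis.Calculus.Deriv.Mul
import Mathlib.Analysis.Calculus.Deriv.Comp
import Mathlib.Topology.MetricSpace.ProperSpace
import HarnessLib

/-!
# Elementary geometry of cones: coordinate bounds, radial tangency, scaling of Hausdorff measure

Three elementary facts about a CONE `S ⊆ V` (a subset invariant under dilations) in a
finite-dimensional inner product space, used for tangent cones of analytic sets and for the
quantisation of the Lelong number of a conic holomorphic chain ([Chirka1989, §15.1 Prop. 2, the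
case of a cone]; [Harvey1977, §1.9–1.10]):

* `exists_norm_proj_le_of_cone` — **coordinate bound from an isolating subspace**: if `S` is
  closed, invariant under positive real dilations, and meets the complex (or real) subspace `L`
  only in `0`, then `‖P_L z‖ ≤ M ‖P_{Lᗮ} z‖` on `S` for the orthogonal projections `P_L`, `P_{Lᗮ}`
  ("`|z''| ≤ M |z'|` in coordinates `z = (z', z'')` adapted to `Lᗮ ⊕ L`"): compactness of
  `S ∩ {‖z‖ = 1}` [Chirka1989, §8.1, proof of Prop. 1];
* `fderiv_apply_self_eq_zero_of_cone` — **the radial vector is tangent to a cone**: if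
  `g (t • x) = g x` for `t` near `1` and `g` is differentiable at `x`, then `g'(x) x = 0`; hence at
  a regular point `x` of a conic set cut out by `g`, `x ∈ T_x S = ker g'(x)` [folklore];
* `euclideanHausdorffMeasure_inter_ball_eq_of_cone` — **scaling**: if `t • S ⊆ S` for all `t > 0`
  then `μHE[d] (S ∩ B(0, ρ)) = ρ^d · μHE[d] (S ∩ B(0, 1))` [folklore].

Theorems only; Mathlib-only imports.

## References

* E. M. Chirka, *Complex Analytic Sets*, Kluwer 1989, §8.1, §15.1 [Chirka1989].
* R. Harvey, *Holomorphic chains and their boundaries*, PSPUM XXX.1 (1977), §1.9 [Harvey1977].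
-/

open scoped ENNReal NNReal Topology Pointwise
open Set Filter Metric MeasureTheory MeasureTheory.Measure

noncomputable section

namespace Literature.Geometry.GeometricMeasureTheory

/-! ### The coordinate bound `‖z''‖ ≤ M ‖z'‖` on a cone missing `L` -/

section Isolating

variable {V : Type*} [NormedAddCommGroup V] [InnerProductSpace ℂ V] [FiniteDimensional ℂ V]

/-- **Coordinate bound for a cone from an isolating subspace.** Let `S ⊆ V` be closed and
invariant under positive real dilations (`t • S ⊆ S` for `t > 0`), and let `L` be a complex
subspace with `S ∩ L ⊆ {0}`. Then there is `M ≥ 0` with `‖P_L z‖ ≤ M ‖P_{Lᗮ} z‖` for all `z ∈ S`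
(`P` the orthogonal projections; "`|z''| ≤ M |z'|` in unitary coordinates `z = (z', z'')` adapted to
`Lᗮ ⊕ L`"): on the compact set `S ∩ {‖z‖ = 1}` the continuous function `‖P_{Lᗮ} z‖` does not vanish,
hence is `≥ m > 0`, and both sides are homogeneous. [Chirka1989, §8.1, proof of Prop. 1]
[cite: Chirka1989, §8.1 Prop. 1] -/
theorem exists_norm_proj_le_of_cone {S : Set V} (hS : IsClosed S)
    (hcone : ∀ t : ℝ, 0 < t → t • S ⊆ S) (L : Submodule ℂ V) (hL : S ∩ L ⊆ {0}) :
    ∃ M : ℝ, 0 ≤ M ∧ ∀ z ∈ S, ‖L.starProjection z‖ ≤ M * ‖Lᗮ.starProjection z‖ := by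
  set P := Lᗮ.starProjection with hP
  -- the compact set `K = S ∩ sphere 0 1`
  set K : Set V := S ∩ sphere (0 : V) 1 with hK
  haveI : ProperSpace V := FiniteDimensional.proper_rclike ℂ V
  have hKc : IsCompact K :=
    (isCompact_sphere (0 : V) 1).of_isClosed_subset (hS.inter isClosed_sphere) inter_subset_right
  -- normalisation of a nonzero point of `S` lands in `K`
  have hnorm : ∀ z ∈ S, z ≠ 0 → (‖z‖⁻¹ : ℝ) • z ∈ K := by
    intro z hz hz0
    have hn : 0 < ‖z‖ := norm_pos_iff.2 hz0
    refine ⟨hcone _ (inv_pos.2 hn) (smul_mem_smul_set hz), ?_⟩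
    rw [mem_sphere_zero_iff_norm, norm_smul, norm_inv, norm_norm, inv_mul_cancel₀ hn.ne']
  rcases K.eq_empty_or_nonempty with hKe | hKne
  · -- `S ⊆ {0}`: any `M` works
    refine ⟨0, le_rfl, fun z hz => ?_⟩
    have hz0 : z = 0 := by
      by_contra h
      have := hnorm z hz h
      rw [hKe] at this
      exact this
    subst hz0
    simp
  · -- `‖P z‖` is continuous and positive on `K`
    have hcont : ContinuousOn (fun z : V => ‖P z‖) K :=
      (continuous_norm.comp P.continuous).continuousOn
    obtain ⟨z₀, hz₀K, hmin⟩ := hKc.exists_isMinOn hKne hcont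
    set m : ℝ := ‖P z₀‖ with hm
    have hm0 : 0 < m := by
      rw [hm, norm_pos_iff]
      intro hPz
      -- `P z₀ = 0` means `z₀ ∈ Lᗮᗮ = L`, so `z₀ ∈ S ∩ L = {0}`, contradicting `‖z₀‖ = 1`
      have hzL : z₀ ∈ L := by
        have h1 : z₀ ∈ Lᗮᗮ := (Submodule.starProjection_apply_eq_zero_iff (K := Lᗮ)).1 hPz
        rwa [Submodule.orthogonal_orthogonal] at h1
      have h0 : z₀ ∈ ({0} : Set V) := hL ⟨hz₀K.1, hzL⟩
      have hn : ‖z₀‖ = 1 := mem_sphere_zero_iff_norm.1 hz₀K.2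
      rw [mem_singleton_iff] at h0
      rw [h0, norm_zero] at hn
      exact zero_ne_one hn
    refine ⟨1 / m, by positivity, fun z hz => ?_⟩
    rcases eq_or_ne z 0 with rfl | hz0
    · simp
    have hn : 0 < ‖z‖ := norm_pos_iff.2 hz0
    -- `m ≤ ‖P (z/‖z‖)‖ = ‖P z‖/‖z‖`
    have hmu : m ≤ ‖P ((‖z‖⁻¹ : ℝ) • z)‖ := by
      have := hmin (hnorm z hz hz0)
      simpa [hm] using this
    have h1 : ‖P ((‖z‖⁻¹ : ℝ) • z)‖ = ‖z‖⁻¹ * ‖P z‖ := by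
      rw [← Complex.coe_smul, map_smul, norm_smul, Complex.norm_real, Real.norm_eq_abs,
        abs_of_pos (inv_pos.2 hn)]
    rw [h1, le_inv_mul_iff₀ hn] at hmu
    -- `‖P_L z‖ ≤ ‖z‖ ≤ ‖P z‖ / m`
    calc ‖L.starProjection z‖ ≤ ‖z‖ := Submodule.norm_starProjection_apply_le L z
      _ ≤ 1 / m * ‖P z‖ := by
          rw [div_mul_eq_mul_div, one_mul, le_div_iff₀ hm0]
          exact hmu

end Isolating

/-! ### The radial vector is tangent to a cone -/

section Radial

variable {E F : Type*} [NormedAddCommGroup E] [NormedSpace ℝ E] [NormedAddCommGroup F]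
  [NormedSpace ℝ F]

/-- **The radial vector field is tangent to a cone.** If `g` is differentiable at `x` and
`g (t • x) = g x` for all real `t` near `1` (e.g. `g` cuts out a conic set `S = g⁻¹(c)` near `x`,
or `g` is constant on `S ∋ t • x`), then `g'(x) x = 0`: the curve `t ↦ t • x` has velocity `x` at
`t = 1` and `g` is constant along it. Hence at a regular point `x` of a cone `S = {g = 0}` (with
`g'(x)` onto), `x ∈ T_x S = ker g'(x)`. [folklore] -/
theorem fderiv_apply_self_eq_zero_of_cone {g : E → F} {g' : E →L[ℝ] F} {x : E}
    (hg : HasFDerivAt g g' x) (h : ∀ᶠ t in 𝓝 (1 : ℝ), g (t • x) = g x) : g' x = 0 := by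
  -- the curve `γ t = t • x` and the composite `g ∘ γ`
  have hγ : HasDerivAt (fun t : ℝ => t • x) x 1 := by
    simpa using (hasDerivAt_id (1 : ℝ)).smul_const x
  have hg1 : HasFDerivAt g g' ((fun t : ℝ => t • x) 1) := by simpa using hg
  have hcomp : HasDerivAt (g ∘ fun t : ℝ => t • x) (g' x) 1 := hg1.comp_hasDerivAt 1 hγ
  -- `g ∘ γ` is constant near `1`
  have hconst : HasDerivAt (g ∘ fun t : ℝ => t • x) 0 1 := by
    refine (hasDerivAt_const (1 : ℝ) (g x)).congr_of_eventuallyEq ?_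
    filter_upwards [h] with t ht
    simp [ht]
  exact hcomp.unique hconst

/-- Complex-linear version: if `g` has complex derivative `g'` at `x` and is constant along the real
ray through `x` near `x`, then `g'(x) x = 0`. [folklore] -/
theorem fderiv_apply_self_eq_zero_of_cone' {E' F' : Type*} [NormedAddCommGroup E']
    [NormedSpace ℂ E'] [NormedAddCommGroup F'] [NormedSpace ℂ F'] {g : E' → F'} {g' : E' →L[ℂ] F'}
    {x : E'} (hg : HasFDerivAt g g' x) (h : ∀ᶠ t in 𝓝 (1 : ℝ), g (t • x) = g x) : g' x = 0 := by
  have := fderiv_apply_self_eq_zero_of_cone (hg.restrictScalars ℝ) h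
  simpa using this

end Radial

/-! ### Scaling of Hausdorff measure on a cone -/

section Scaling

variable {E : Type*} [NormedAddCommGroup E] [NormedSpace ℝ E] [MeasurableSpace E] [BorelSpace E]

omit [MeasurableSpace E] [BorelSpace E] in
/-- For a cone `S` (invariant under positive dilations), `S ∩ B(0, ρ) = ρ • (S ∩ B(0, 1))`.
[folklore] -/
theorem inter_ball_eq_smul_of_cone {S : Set E} (hcone : ∀ t : ℝ, 0 < t → t • S ⊆ S) {ρ : ℝ}
    (hρ : 0 < ρ) : S ∩ ball (0 : E) ρ = ρ • (S ∩ ball (0 : E) 1) := by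
  ext z
  constructor
  · rintro ⟨hzS, hzB⟩
    refine ⟨ρ⁻¹ • z, ⟨hcone _ (inv_pos.2 hρ) (smul_mem_smul_set hzS), ?_⟩, ?_⟩
    · rw [mem_ball_zero_iff, norm_smul, norm_inv, Real.norm_eq_abs, abs_of_pos hρ,
        inv_mul_lt_iff₀ hρ, mul_one]
      exact mem_ball_zero_iff.1 hzB
    · simp [smul_smul, mul_inv_cancel₀ hρ.ne']
  · rintro ⟨w, ⟨hwS, hwB⟩, rfl⟩
    refine ⟨hcone ρ hρ (smul_mem_smul_set hwS), ?_⟩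
    rw [mem_ball_zero_iff, norm_smul, Real.norm_eq_abs, abs_of_pos hρ]
    have := mem_ball_zero_iff.1 hwB
    nlinarith

/-- **Scaling of Hausdorff measure on a cone**: if `t • S ⊆ S` for all `t > 0` then
`μHE[d] (S ∩ B(0, ρ)) = ρ^d · μHE[d] (S ∩ B(0, 1))` for `ρ > 0` (Mathlib's
`euclideanHausdorffMeasure_smul₀`). For the current of a conic holomorphic `p`-chain this is
`‖C‖(B_ρ) = ρ^{2p} ‖C‖(B_1)`. [folklore] -/
theorem euclideanHausdorffMeasure_inter_ball_eq_of_cone {S : Set E}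
    (hcone : ∀ t : ℝ, 0 < t → t • S ⊆ S) (d : ℕ) {ρ : ℝ} (hρ : 0 < ρ) :
    μHE[d] (S ∩ ball (0 : E) ρ) = ENNReal.ofReal (ρ ^ d) * μHE[d] (S ∩ ball (0 : E) 1) := by
  rw [inter_ball_eq_smul_of_cone hcone hρ, euclideanHausdorffMeasure_smul₀ d hρ.ne',
    ENNReal.smul_def, smul_eq_mul]
  congr 1
  rw [ENNReal.ofReal_pow hρ.le, ENNReal.coe_pow, ENNReal.ofReal_eq_coe_nnreal hρ.le]
  congr 2
  ext
  simp [abs_of_pos hρ]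

/-- The mass ratio `μHE[d] (S ∩ B(0,ρ)) / ρ^d` of a cone is constant in `ρ > 0`. [folklore] -/
theorem euclideanHausdorffMeasure_inter_ball_div_eq_of_cone {S : Set E}
    (hcone : ∀ t : ℝ, 0 < t → t • S ⊆ S) (d : ℕ) {ρ : ℝ} (hρ : 0 < ρ) :
    μHE[d] (S ∩ ball (0 : E) ρ) / ENNReal.ofReal (ρ ^ d) = μHE[d] (S ∩ ball (0 : E) 1) := by
  rw [euclideanHausdorffMeasure_inter_ball_eq_of_cone hcone d hρ, mul_comm,
    ENNReal.mul_div_cancel_right]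
  · exact (ENNReal.ofReal_pos.2 (pow_pos hρ d)).ne'
  · exact ENNReal.ofReal_ne_top

end Scaling

end Literature.Geometry.GeometricMeasureTheory

end
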